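import Literature.Probability.Percolation.TriPolyhexDomain
import HarnessLib

/-!
# One-block ring patterns exclude cut vertices

Topic `Literature/Probability/Percolation`; family `crit-perc`. Bollobás–Riordan (*Percolation*
(2006), Ch. 7 §7.2.2 p. 168) restrict discrete domains to those where "neither `G` nor `∂⁺(G)`
has a cut-vertex". This file derives both conditions from a *local* one — at every site, the
neighbours in `G` form one cyclic block of directions (`OneBlockAt`) — which unions of tiles
satisfy automatically (`TriCoarseTiling.lean`), and packages the resulting constructor of
unmarked discrete domains:

* `pathIn_erase_of_oneBlock` — one-block patterns at the sites of a connected `G` exclude cut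
  vertices of `G` (a path to the removed site arrives through one of its neighbours in `G`,
  and these are joined around the ring, `pathIn_block`);
* `pathIn_outer_erase_of_oneBlock` — for a disc with connected complement, one-block patterns
  at the outer sites exclude cut vertices of `∂⁺G`: read from the top dart into an outer site
  `w`, the boundary cycle first runs through the darts into `w` (`triBdrySucc_into`), so the
  remaining heads form a chain of all the other outer sites avoiding `w`;
* `TriMarkedDomain.ofOneBlock` — the constructor (via `TriMarkedDomain.ofPolyhex`).

## References

* B. Bollobás, O. Riordan, *Percolation*, Cambridge University Press (2006), Ch. 7 §7.2.2
  p. 168.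

## Mathlib / tree

Tree: `TriPolyhexDomain.lean` (`ofPolyhex`, `pathIn_ring'`, `snd_triBdrySucc_eq_or_adj`),
`TriPolyhexDisc.lean` (`exists_isTriDisc_of_coconnected`), `TriDiscShelling.lean` (`IsTriDisc`,
`rebase`, `injOn`, `triLeftApex_add_triDir_left`), `SitePaths.lean` (`PathIn.exit`).
-/

noncomputable section

open Finset Literature.Probability.LatticeModels

namespace Literature.Probability.Percolation

/-- The one-block condition on the ring pattern of `G` at a site `x`: the neighbours of `x` in
`G` are all six, none, or one block of `m` consecutive directions. [folklore] -/
def OneBlockAt (G : Finset (Site 2)) (x : Site 2) : Prop :=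
  (∀ j, x + triDir j ∈ G) ∨ (∀ j, x + triDir j ∉ G) ∨
    ∃ a m : Fin 6, 1 ≤ m.val ∧ ∀ t : Fin 6, x + triDir (a + t) ∈ G ↔ t.val < m.val

/-- **Consecutive directions of a block are joined inside `G ∖ {x}`**: the sites
`x + e_{a}, …, x + e_{a+t}` of a block of neighbours in `G` are joined along the ring. [folklore] -/
theorem pathIn_block {G : Finset (Site 2)} {x : Site 2} {a m : Fin 6}
    (hblk : ∀ t : Fin 6, x + triDir (a + t) ∈ G ↔ t.val < m.val) :
    ∀ t : ℕ, t < m.val → PathIn triGraph (↑(G.erase x) : Set (Site 2)) (x + triDir a) (x + triDir (a + Fin.ofNat 6 t)) := by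
  have hmem : ∀ t : ℕ, t < m.val → x + triDir (a + Fin.ofNat 6 t) ∈ (↑(G.erase x) : Set (Site 2)) := by
    intro t ht
    have hm := m.isLt
    refine mem_coe.2 (mem_erase.2 ⟨add_triDir_ne _ _, (hblk _).2 ?_⟩)
    rw [Fin.val_ofNat, Nat.mod_eq_of_lt (by omega)]; exact ht
  intro t
  induction t with
  | zero => intro h0; simpa using PathIn.refl (by simpa using hmem 0 h0)
  | succ t ih =>
    intro ht
    have e : a + Fin.ofNat 6 (t + 1) = a + Fin.ofNat 6 t + 1 := by
      rw [add_assoc]; congr 1; apply Fin.ext; rw [Fin.val_add, Fin.val_ofNat, Fin.val_ofNat]; simp [Nat.add_mod]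
    rw [e]
    exact (ih (by omega)).tail (triGraph_adj_consec x _) (by rw [← e]; exact hmem _ ht)

/-- **One-block patterns at the sites of `G` exclude cut vertices of `G`**: if `G` is connected
and the neighbours in `G` of every site of `G` form one cyclic block, removing any site leaves
`G` connected (a path to the removed site `v` arrives through a neighbour of `v` in `G`, and
these neighbours are joined around the ring). [folklore] -/
theorem pathIn_erase_of_oneBlock {G : Finset (Site 2)}
    (hconn : ∀ p ∈ G, ∀ q ∈ G, PathIn triGraph (↑G : Set (Site 2)) p q)
    (hblk : ∀ v ∈ G, OneBlockAt G v) (v : Site 2) (hv : v ∈ G) :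
    ∀ p ∈ G.erase v, ∀ q ∈ G.erase v, PathIn triGraph (↑(G.erase v) : Set (Site 2)) p q := by
  -- every site of `G ∖ {v}` reaches a neighbour of `v` inside `G ∖ {v}`
  have arrive : ∀ p ∈ G.erase v, ∃ j : Fin 6, v + triDir j ∈ G ∧
      PathIn triGraph (↑(G.erase v) : Set (Site 2)) p (v + triDir j) := by
    intro p hp
    obtain ⟨hpv, hpG⟩ := mem_erase.1 hp
    obtain ⟨a, b, ha, hb, hbG, hab, hpa⟩ := (hconn p hpG v hv).exit (R := {x | x ≠ v}) hpv (fun h => h rfl)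
    have hbv : b = v := by by_contra h; exact hb h
    subst hbv
    obtain ⟨j, rfl⟩ := (triGraph_adj_iff_triDir b a).1 hab.symm
    refine ⟨j, mem_coe.1 (Set.inter_subset_right hpa.right_mem), hpa.mono fun x hx => ?_⟩
    exact mem_coe.2 (mem_erase.2 ⟨hx.1, mem_coe.1 hx.2⟩)
  -- any two neighbours of `v` in `G` are joined inside `G ∖ {v}`
  have link : ∀ i j : Fin 6, v + triDir i ∈ G → v + triDir j ∈ G →
      PathIn triGraph (↑(G.erase v) : Set (Site 2)) (v + triDir i) (v + triDir j) := by
    intro i j hi hj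
    rcases hblk v hv with hall | hnone | ⟨a, m, hm1, hb⟩
    · exact pathIn_ring' (fun k => mem_coe.2 (mem_erase.2 ⟨add_triDir_ne _ _, hall k⟩)) i j
    · exact absurd hi (hnone i)
    · obtain ⟨s, rfl⟩ := RemovableAt.exists_offset a i
      obtain ⟨t, rfl⟩ := RemovableAt.exists_offset a j
      have hs := (hb s).1 hi
      have ht := (hb t).1 hj
      have h1 := pathIn_block hb s.val hs
      have h2 := pathIn_block hb t.val ht
      have es : Fin.ofNat 6 s.val = s := Fin.ext (by rw [Fin.val_ofNat, Nat.mod_eq_of_lt s.isLt])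
      have et : Fin.ofNat 6 t.val = t := Fin.ext (by rw [Fin.val_ofNat, Nat.mod_eq_of_lt t.isLt])
      rw [es] at h1; rw [et] at h2
      exact h1.symm.trans h2
  intro p hp q hq
  obtain ⟨i, hi, hpi⟩ := arrive p hp
  obtain ⟨j, hj, hqj⟩ := arrive q hq
  exact (hpi.trans (link i j hi hj)).trans hqj.symm

/-! ### Outer sites: the darts into an outer site form one run of the boundary cycle -/

/-- **The successor of a dart into an outer site `w`** turns clockwise around `w` while the
next ring site is in `G`. [folklore] -/
theorem triBdrySucc_into {G : Finset (Site 2)} {w : Site 2} (k : Fin 6) (hk : w + triDir (k + 5) ∈ G) :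
    triBdrySucc G (w + triDir k, w) = (w + triDir (k + 5), w) := by
  simp only [triBdrySucc, triLeftApex_add_triDir_left, if_pos hk]

/-- An outer site of a set with connected (infinite) complement has an outside neighbour. [folklore] -/
theorem exists_add_triDir_not_mem {G : Finset (Site 2)} {w : Site 2} (hw : w ∉ G)
    (hco : ∀ o ∉ G, ∀ o' ∉ G, PathIn triGraph ((↑G : Set (Site 2))ᶜ) o o') : ∃ j, w + triDir j ∉ G := by
  obtain ⟨o, ho⟩ := (insert w G).exists_notMem
  rw [mem_insert, not_or] at ho
  obtain ⟨-, hR⟩ := hco w hw o ho.2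
  rcases hR.cases_head with e | ⟨c, ⟨hadj, hc⟩, -⟩
  · exact absurd e.symm ho.1
  · obtain ⟨j, rfl⟩ := (triGraph_adj_iff_triDir w c).1 hadj
    exact ⟨j, fun h => hc (mem_coe.2 h)⟩

/-- **One-block patterns at the outer sites exclude cut vertices of the outer boundary** of a
disc with connected complement: reading the boundary cycle from the top dart into an outer
site `w`, the darts into `w` come first, as one run, so the remaining heads — all the other
outer sites, consecutive ones equal or adjacent — form a connected chain avoiding `w`. [folklore] -/
theorem pathIn_outer_erase_of_oneBlock {G : Finset (Site 2)} {b₀ : Site 2 × Site 2} (hD : IsTriDisc G b₀)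
    (hco : ∀ o ∉ G, ∀ o' ∉ G, PathIn triGraph ((↑G : Set (Site 2))ᶜ) o o')
    (hblk : ∀ w ∈ triOuterBdry G, OneBlockAt G w) (w : Site 2) (hw : w ∈ triOuterBdry G) :
    ∀ p ∈ (triOuterBdry G).erase w, ∀ q ∈ (triOuterBdry G).erase w,
      PathIn triGraph (↑((triOuterBdry G).erase w) : Set (Site 2)) p q := by
  -- `w` is the head of a boundary dart: outside `G`, with a neighbour in `G`
  obtain ⟨d, hd, hdw⟩ := mem_image.1 hw
  obtain ⟨hd1, hd2, hdadj⟩ := mem_triBdryDarts.1 hd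
  rw [hdw] at hd2 hdadj
  -- the block of neighbours of `w` in `G`
  obtain ⟨a, m, hm1, hb⟩ : ∃ a m : Fin 6, 1 ≤ m.val ∧ ∀ t : Fin 6, w + triDir (a + t) ∈ G ↔ t.val < m.val := by
    rcases hblk w hw with hall | hnone | h
    · obtain ⟨j, hj⟩ := exists_add_triDir_not_mem hd2 hco
      exact absurd (hall j) hj
    · obtain ⟨j, hj⟩ := (triGraph_adj_iff_triDir w d.1).1 hdadj.symm
      exact absurd (hj ▸ hd1) (hnone j)
    · exact h
  have hm5 : m.val ≤ 5 := Nat.lt_succ_iff.1 m.isLt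
  -- the top dart into `w` and the disc read from it
  set d₀ : Site 2 × Site 2 := (w + triDir (a + (m - 1)), w) with hd₀
  have hvm1 : (m - 1).val = m.val - 1 := by
    rw [Fin.coe_sub_one]; split_ifs with h0
    · simp [h0] at hm1
    · rfl
  have hd₀mem : d₀ ∈ triBdryDarts G :=
    mem_triBdryDarts.2 ⟨(hb (m - 1)).2 (by rw [hvm1]; omega), hd2, (triGraph_adj_add_triDir w _).symm⟩
  have hm1' : Fin.ofNat 6 (m.val - 1) = m - 1 := Fin.ext (by rw [Fin.val_ofNat, hvm1, Nat.mod_eq_of_lt (by omega)])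
  have hP := hD.rebase hd₀mem
  set L := #(triBdryDarts G) with hL
  -- the first `m` darts are the darts into `w`, from the top of the block down
  have hrun : ∀ t : ℕ, t < m.val → triBdryIter G d₀ t = (w + triDir (a + Fin.ofNat 6 (m.val - 1 - t)), w) := by
    intro t
    induction t with
    | zero =>
      intro _
      rw [triBdryIter_zero, hd₀, Nat.sub_zero, hm1']
    | succ t ih =>
      intro ht
      rw [triBdryIter_succ, ih (by omega), triBdrySucc_into]
      · congr 3
        rw [add_assoc]; congr 1; apply Fin.ext
        rw [Fin.val_add, Fin.val_ofNat, Fin.val_ofNat]; simp; omega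
      · rw [add_assoc]
        refine (hb _).2 ?_
        rw [Fin.val_add, Fin.val_ofNat]; simp; omega
  -- later heads are not `w`
  have hlater : ∀ n, m.val ≤ n → n < L → (triBdryIter G d₀ n).2 ≠ w := by
    intro n hmn hnL e
    have hdn := triBdryIter_mem hd₀mem n
    obtain ⟨hx, -, hadj⟩ := mem_triBdryDarts.1 hdn
    rw [e] at hadj
    obtain ⟨j, hj⟩ := (triGraph_adj_iff_triDir w _).1 hadj.symm
    obtain ⟨s, rfl⟩ := RemovableAt.exists_offset a j
    have hs : s.val < m.val := (hb s).1 (hj ▸ hx)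
    have heq : triBdryIter G d₀ n = triBdryIter G d₀ (m.val - 1 - s.val) := by
      rw [hrun (m.val - 1 - s.val) (by omega)]
      have es : Fin.ofNat 6 (m.val - 1 - (m.val - 1 - s.val)) = s := by
        apply Fin.ext; rw [Fin.val_ofNat, show m.val - 1 - (m.val - 1 - s.val) = s.val by omega,
          Nat.mod_eq_of_lt s.isLt]
      rw [es]; exact Prod.ext hj e
    have := hP.injOn (mem_coe.2 (mem_range.2 hnL)) (mem_coe.2 (mem_range.2 (by omega))) heq
    omega
  -- the chain of the later heads avoids `w`
  have hheadmem : ∀ n, m.val ≤ n → n < L →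
      (triBdryIter G d₀ n).2 ∈ (↑((triOuterBdry G).erase w) : Set (Site 2)) := fun n hmn hnL =>
    mem_coe.2 (mem_erase.2 ⟨hlater n hmn hnL, mem_image_of_mem _ (triBdryIter_mem hd₀mem n)⟩)
  have hchain : ∀ n, m.val ≤ n → n < L → PathIn triGraph (↑((triOuterBdry G).erase w) : Set (Site 2))
      (triBdryIter G d₀ m.val).2 (triBdryIter G d₀ n).2 := by
    intro n hmn hnL
    induction n with
    | zero =>
      have : m.val = 0 := by omega
      rw [this]; exact PathIn.refl (this ▸ hheadmem 0 (by omega) hnL)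
    | succ n ih =>
      rcases Nat.lt_or_ge n m.val with hlt | hge
      · have e : n + 1 = m.val := by omega
        rw [e]; exact PathIn.refl (hheadmem _ le_rfl (e ▸ hnL))
      · have ih' := ih hge (by omega)
        rw [triBdryIter_succ]
        rcases snd_triBdrySucc_eq_or_adj G (mem_triBdryDarts.1 (triBdryIter_mem hd₀mem n)).2.2 with e | hadj
        · rw [e]; exact ih'
        · exact ih'.tail hadj (by rw [← triBdryIter_succ]; exact hheadmem _ (by omega) hnL)
  -- every other outer site is a later head
  have hpos : ∀ p ∈ (triOuterBdry G).erase w, ∃ n, m.val ≤ n ∧ n < L ∧ (triBdryIter G d₀ n).2 = p := by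
    intro p hp
    obtain ⟨hpw, hp'⟩ := mem_erase.1 hp
    obtain ⟨d', hd', rfl⟩ := mem_image.1 hp'
    obtain ⟨n, hn, rfl⟩ := hP.cycle d' hd'
    refine ⟨n, ?_, hn, rfl⟩
    by_contra hlt; push Not at hlt
    exact hpw (by rw [hrun n hlt])
  intro p hp q hq
  obtain ⟨n, hmn, hnL, rfl⟩ := hpos p hp
  obtain ⟨n', hmn', hn'L, rfl⟩ := hpos q hq
  exact (hchain n hmn hnL).symm.trans (hchain n' hmn' hn'L)

/-! ### The constructor -/

/-- **A discrete domain from a hole-free polyhex with one-block ring patterns**: a finite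
nonempty connected set of sites with connected complement, at every site of which and of whose
outer boundary the neighbours in the set form one cyclic block, is an unmarked discrete domain
— the cut-vertex conditions of Bollobás–Riordan (2006, Ch. 7 §7.2.2 p. 168) follow from the
patterns (`pathIn_erase_of_oneBlock`, `pathIn_outer_erase_of_oneBlock`). [cite: BollobasRiordan2006, Ch. 7 §7.2.2 p. 168] -/
def TriMarkedDomain.ofOneBlock (G : Finset (Site 2)) (hne : G.Nonempty)
    (hconn : ∀ p ∈ G, ∀ q ∈ G, PathIn triGraph (↑G : Set (Site 2)) p q)
    (hco : ∀ o ∉ G, ∀ o' ∉ G, PathIn triGraph ((↑G : Set (Site 2))ᶜ) o o')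
    (hblk : ∀ x, x ∈ G ∨ x ∈ triOuterBdry G → OneBlockAt G x) : TriMarkedDomain 0 :=
  TriMarkedDomain.ofPolyhex G hne hconn hco
    (fun v hv => pathIn_erase_of_oneBlock hconn (fun x hx => hblk x (Or.inl hx)) v hv)
    (fun w hw => pathIn_outer_erase_of_oneBlock
      (Classical.choose_spec (exists_isTriDisc_of_coconnected _ G rfl hne hconn hco)) hco
      (fun x hx => hblk x (Or.inr hx)) w hw)

/-- The site set of `ofOneBlock`. [folklore] -/
@[simp] theorem TriMarkedDomain.ofOneBlock_verts (G : Finset (Site 2)) (hne : G.Nonempty) (hconn) (hco) (hblk) :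
    (TriMarkedDomain.ofOneBlock G hne hconn hco hblk).verts = G := rfl

end Literature.Probability.Percolation
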